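import Literature.MathematicalPhysics.QuantumLattice.RandomField
import Literature.MathematicalPhysics.QuantumLattice.EuclideanAction
import Literature.MathematicalPhysics.QuantumLattice.SchwartzTensor
import Literature.MathematicalPhysics.QuantumLattice.FreeCovariance
import Literature.MathematicalPhysics.QuantumLattice.OSAxiomsMeasure
import Literature.MathematicalPhysics.QuantumLattice.SchwingerOSAxioms
import HarnessLib

-- provenance: harness21/H21/H21/Statements/ConstructiveQFT/OSAxioms.lean @ 3cd5f34 (interim HEAD d8f2665); M5 mechanical rewrite
/-!
# Osterwalder–Schrader axioms, the free field and Bochner–Minlos: target statements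

Trunk **T-AQFT** (G13), family `constructive-qft`, statements **constructive-qft.S06**
(OS axioms, definition role), **constructive-qft.S07** (the free Euclidean field of mass `m > 0`
exists, is unique, and satisfies OS0–OS4 with mass gap `m`) and **constructive-qft.S08**
(Bochner–Minlos theorem). Notions: `os_axioms`, `schwinger_functions`, `free_field_covariance`,
`random_distribution_law`, `nuclear_space_minlos`.

Throughout, `ℝ^d` is written `EuclideanSpace ℝ (Fin d)` (no abbreviation, outline §0), with
`[NeZero d]` (the texts' `d ≥ 1`; time is coordinate `0`) wherever reflection or time translation
enters. All vocabulary comes from the accepted prelude: `FieldConfig`, `genFunctional`, `moment`,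
`IsCharacteristicFunctional` (`RandomField`); `IsOSMeasure`, `IsOS1Regular`,
`IsOS3ReflectionPositive`, `HasExponentialClustering` (`OSAxiomsMeasure`); `SchwingerFamily`,
`IsSchwingerFamilyOf` (`SchwartzTensor`); `SchwingerFamily.IsOSFamily`,
`SchwingerFamily.HasLinearGrowth` (`SchwingerOSAxioms`); `IsFreeField`, `freeCovarianceReal`
(`FreeCovariance`).

## Contents

* S06: `IsOSMeasure.exists_isOSFamily'` — an OS measure (Glimm–Jaffe form OS0–OS4) has Schwinger
  functions satisfying the Osterwalder–Schrader axioms E1–E4 (`IsOSFamily`), and, when OS1 holds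
  with an exponent `p < 2`, also the linear growth condition E0' (`HasLinearGrowth`, kept as a
  separate conjunct, outline A6/F12e); `isOS3ReflectionPositive_iff_posSemidef` — OS3 in matrix
  form.
* S07: `existsUnique_freeField`, `freeFieldMeasure`, `freeFieldMeasure_spec`,
  `IsFreeField.isOSMeasure`, `IsFreeField.hasExponentialClustering`.
* S08: `bochner_minlos` and the packaged equivalence
  `isCharacteristicFunctional_iff_exists_measure` (whose easy direction is the prelude's
  `isCharacteristicFunctional_genFunctional`, re-exported as
  `genFunctional_isCharacteristicFunctional`).

## Sources

* K. Osterwalder, R. Schrader, *Axioms for Euclidean Green's functions I, II*, Comm. Math.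
  Phys. 31 (1973) 83–112, §§2–3; 42 (1975) 281–305, §2 (E0').
* J. Glimm, A. Jaffe, *Quantum Physics: a functional integral point of view* (2nd ed. 1987),
  §6.1 (OS0–OS4), §6.2 (Gaussian measures, the free field: Prop. 6.2.2, Thms 6.2.2–6.2.4),
  §7.10 (reflection positivity of `(-Δ + m²)⁻¹`), Ch. 19 (from OS measures to the OS axioms
  for Schwinger functions; regularity and growth of Schwinger functions, §19.1 and Thm 19.x —
  the outline's locator, unverified against the printed numbering), Thm A.6.1? (Minlos; the
  inventory marks this locator with '?').
* E. Nelson, *The free Markoff field*, J. Funct. Anal. 12 (1973) 211–227.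
* R. A. Minlos, Trudy Moskov. Mat. Obšč. 8 (1959) 497–518; I. M. Gel'fand, N. Ya. Vilenkin,
  *Generalized Functions IV* (1964), Ch. IV §2 Thm 2 / §3 Thm 3.
* Lean precedent (design reference only, nothing imported): M. Douglas, S. Hoback, A. Mei,
  R. Nissim, *OSforGFF* (OS axioms for the Gaussian free field, `d = 4`), arXiv:2603.15770.

## Mathlib

Used: `Matrix.PosSemidef` with the scoped `ComplexOrder` on `ℂ`
(`Matrix.posSemidef_iff_dotProduct_mulVec`), `ProbabilityTheory.IsGaussian` (through
`IsGaussianField`), `MeasureTheory.IsProbabilityMeasure`, `ExistsUnique`. Searched and absent at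
the pin: Minlos / Bochner–Minlos for nuclear spaces (`Minlos`, `charFun` only for normed duals:
`MeasureTheory.charFunDual`, `Measure.ext_of_charFunDual`), the free field / Gaussian free field
(`FreeField`, `GFF`), Osterwalder–Schrader vocabulary. Nothing is redefined here.

## Design

* This is a statements file: no new predicates are introduced; the only definition is the
  named free-field measure `freeFieldMeasure d m` (by choice from `∃ μ, IsFreeField m μ`, junk
  value `0` when no free field of mass `m` exists, e.g. never for `m ≠ 0` by S07).
* Dot-notation lemmas on prelude predicates (`IsOSMeasure.exists_isOSFamily'`,
  `IsFreeField.isOSMeasure`, `IsFreeField.hasExponentialClustering`) are declared in the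
  prelude namespace `Literature.AQFT` (deliberate dot-notation extensions, so that `hμ.isOSMeasure`
  elaborates); everything else lives in `Literature.ConstructiveQFT`.
* **Mass gap of the free field.** The prelude predicate `HasExponentialClustering d μ m` asks
  `|⟨ω(f); ω(T_t g)⟩| ≤ C e^{-mt}` for *all* Schwartz `f, g`. For the free field this fails:
  already for `d = 1` (covariance kernel `e^{-m|x-y|}/2m`) and positive Schwartz `f = g` with tails
  `exp (-|x|^{1/2})`, the truncated two-point function decays only like `exp (-√(2t))`. The true
  statement (Glimm–Jaffe Thm 6.2.4: the free Hamiltonian has gap `m`) is exponential clustering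
  at rate `m` for `f` supported at negative and `g` at positive times (transfer-matrix form
  `⟨θf̄ Ω, e^{-tH} g Ω⟩`), equivalently for compactly supported `f, g`. We therefore state
  `IsFreeField.hasExponentialClustering` in the positive-time form and record the discrepancy
  for the maintainers of `OSAxiomsMeasure` (whose `HasExponentialClustering` should probably be
  restricted likewise before it is consumed by cqft.S01/S03).
* S06 (definition role) is carried by the contentful bridge `IsOSMeasure.exists_isOSFamily'`;
  compared with the prelude's `IsOSMeasure.exists_isOSFamily` it drops the continuity-of-moments
  hypothesis (derived from OS0–OS1, Glimm–Jaffe §19.1) and adds the E0' conjunct under `p < 2`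
  as instructed by the outline.
* S08 is stated over an arbitrary finite-dimensional real normed space `E` (the generality of
  the prelude's `ext_of_genFunctional`); `𝓢(ℝ^d)` is the case `E = EuclideanSpace ℝ (Fin d)`.
  The σ-algebra on `FieldConfig E` is the Borel σ-algebra of the weak-* topology, which on
  `𝒮'(E)` coincides with the cylinder σ-algebra of Minlos' theorem (`𝒮'` is a Lusin space).
-/

open scoped SchwartzMap ComplexConjugate ComplexOrder
open MeasureTheory Filter Topology Complex

noncomputable section

/-! ### S06: OS measures and OS Schwinger families -/

namespace Literature.MathematicalPhysics.QuantumFieldTheory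

variable {d : ℕ} [NeZero d]

/-- **constructive-qft.S06** (Osterwalder–Schrader axioms; OS, CMP 31 (1973) §§2–3;
Glimm–Jaffe (1987) §6.1 and Ch. 19). The two forms of the OS axioms formalised in the prelude —
Glimm–Jaffe's measure form OS0 analyticity, OS1 regularity, OS2 invariance, OS3 reflection
positivity, OS4 ergodicity (`IsOSMeasure d μ`), and Osterwalder–Schrader's distributional form
for Schwinger functions `𝔖ₙ ∈ 𝒮'(ℝ^{dn})`: E1 Euclidean covariance, E2 reflection positivity
`∑ₙₘ 𝔖ₙ₊ₘ(Θfₙ* ⊗ fₘ) ≥ 0` on positive-time test functions, E3 symmetry, E4 cluster property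
(`SchwingerFamily.IsOSFamily`), plus the temperedness/linear-growth condition E0'
(`SchwingerFamily.HasLinearGrowth`) — are related as follows. If `μ` is an OS measure on
`𝒮'(ℝ^d)`, then its moments `∫ ∏ᵢ ω(fᵢ) dμ` are the values on `f₁ ⊗ ⋯ ⊗ fₙ` of a (unique)
Schwinger family `𝔖`, and `𝔖` satisfies `𝔖₀ = 1` and E1–E4; if moreover OS1 holds with an
exponent `p < 2`, then `𝔖` also satisfies the linear growth condition E0' of OS II
(Glimm–Jaffe §19.1, Prop. 19.1.1 and Thm 19.x (growth `|𝔖ₙ(f)| ≤ α (n!)^β |f|_{ns}`);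
Osterwalder–Schrader II, CMP 42 (1975) §2). Specialisation/strengthening of the prelude bridge
`IsOSMeasure.exists_isOSFamily` (no continuity-of-moments hypothesis: it follows from OS0–OS1).
Known theorem; proof deferred. [cite: GlimmJaffe1987] -/
def _root_.Literature.MathematicalPhysics.QuantumLattice.IsOSMeasure.exists_isOSFamily' : Prop :=
  ∀ {μ : Measure (QuantumLattice.FieldConfig (EuclideanSpace ℝ (Fin d)))} (hμ : QuantumLattice.IsOSMeasure d μ),
    ∃ S : QuantumLattice.SchwingerFamily (EuclideanSpace ℝ (Fin d)),
      QuantumLattice.IsSchwingerFamilyOf μ S ∧ S.IsOSFamily ∧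
        ∀ p c : ℝ, QuantumLattice.IsOS1Regular μ p c → p < 2 → S.HasLinearGrowth

end Literature.MathematicalPhysics.QuantumFieldTheory

namespace Literature.MathematicalPhysics.QuantumFieldTheory

open QuantumLattice

variable {d : ℕ} [NeZero d]

/-- **Reflection positivity in matrix form** (Glimm–Jaffe §6.1, (6.1.4)). For a probability
measure `μ` on `𝒮'(ℝ^d)`, OS3 — `∑ᵢⱼ c̄ᵢ cⱼ S{fⱼ - θfᵢ} ≥ 0` for positive-time `f₁, …, fₙ` and
all `c ∈ ℂⁿ` — holds if and only if every matrix `Mᵢⱼ = S{fⱼ - θfᵢ}` (positive-time `fᵢ`) is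
positive semidefinite (`Matrix.PosSemidef`, for the star order on `ℂ`). The forward direction
(which also needs Hermitian symmetry `S{-h} = conj S{h}`, `θ² = 1`) is the prelude's
`IsOS3ReflectionPositive.posSemidef`. [folklore] -/
def isOS3ReflectionPositive_iff_posSemidef : Prop :=
  ∀ {μ : Measure (FieldConfig (EuclideanSpace ℝ (Fin d)))} [IsProbabilityMeasure μ],
    IsOS3ReflectionPositive d μ ↔
      ∀ (n : ℕ) (f : Fin n → 𝓢(EuclideanSpace ℝ (Fin d), ℝ)), (∀ i, IsPositiveTime (f i)) →
        (Matrix.of fun i j : Fin n => genFunctional μ (f j - thetaTest d (f i))).PosSemidef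

/- interim proof relied on results that are now named facts (D-0014); demoted to a fact by the M5 import, proof preserved:
:= by
  refine ⟨fun h n f hf => h.posSemidef f hf, fun h n c f hf => ?_⟩
  have hM := (h n f hf).dotProduct_mulVec_nonneg c
  have hz : dotProduct (star c)
      ((Matrix.of fun i j : Fin n => genFunctional μ (f j - thetaTest d (f i))).mulVec c) =
        ∑ i, ∑ j, conj (c i) * c j * genFunctional μ (f j - thetaTest d (f i)) := by
    simp only [dotProduct, Matrix.mulVec, Matrix.of_apply, Pi.star_apply, Finset.mul_sum]
    refine Finset.sum_congr rfl fun i _ => Finset.sum_congr rfl fun j _ => ?_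
    simp only [RCLike.star_def]
    ring
  rw [hz] at hM
  exact ⟨(Complex.nonneg_iff.1 hM).1, (Complex.nonneg_iff.1 hM).2.symm⟩
-/

/-! ### S07: the free Euclidean field -/

/-- **constructive-qft.S07** (existence and uniqueness of the free field; Glimm–Jaffe (1987)
§6.2, Thms 6.2.2–6.2.3; Nelson, JFA 12 (1973); Lean precedent OSforGFF, arXiv:2603.15770, for
`d = 4`). For `m > 0` and `d ≥ 1` there is a unique centred Gaussian probability measure `μ_m` on
`𝒮'(ℝ^d)` with `∫ exp (i Φ(f)) dμ_m = exp (-½ ⟨f, (-Δ + m²)⁻¹ f⟩)` for all real test functions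
`f`, i.e. a unique `μ` with `IsFreeField m μ`. Existence is Minlos' theorem (S08) applied to the
continuous positive-definite functional `exp (-½ C_m(f, f))`; uniqueness is
`ext_of_genFunctional`. Known theorem; proof deferred. [cite: GlimmJaffe1987] -/
def existsUnique_freeField : Prop :=
  ∀ (d : ℕ) [NeZero d] (m : ℝ) (hm : 0 < m),
    ∃! μ : Measure (FieldConfig (EuclideanSpace ℝ (Fin d))), IsFreeField m μ

/-- The *free field measure* `μ_m` of mass `m` on `𝒮'(ℝ^d)` (Glimm–Jaffe §6.2; Nelson 1973): a
measure with `IsFreeField m μ`, chosen by `Classical.choice` when one exists (always, for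
`m > 0`, by `existsUnique_freeField`, and then unique). Junk value: the zero measure if no free
field of mass `m` exists. The definition makes sense for every `d` (no `NeZero d` is needed to
*choose* the measure; it is needed only for the OS properties below). [cite: Nelson1973] -/
def freeFieldMeasure (d : ℕ) (m : ℝ) :
    Measure (FieldConfig (EuclideanSpace ℝ (Fin d))) := by
  classical
  exact if h : ∃ μ : Measure (FieldConfig (EuclideanSpace ℝ (Fin d))), IsFreeField m μ
    then h.choose else 0

/-- Defining property of `freeFieldMeasure`: for `m > 0` it is the free field of mass `m`
(Glimm–Jaffe §6.2, Thm 6.2.3). [folklore] -/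
def freeFieldMeasure_spec : Prop :=
  ∀ (d : ℕ) [NeZero d] {m : ℝ} (hm : 0 < m),
    IsFreeField m (freeFieldMeasure d m)

/- interim proof relied on results that are now named facts (D-0014); demoted to a fact by the M5 import, proof preserved:
:= by
  classical
  have h : ∃ μ : Measure (FieldConfig (EuclideanSpace ℝ (Fin d))), IsFreeField m μ :=
    (existsUnique_freeField d m hm).exists
  simp only [freeFieldMeasure, dif_pos h]
  exact h.choose_spec
-/

-- Binder repair (2026-08-16): the header instance deliberately shadows the section's, which a
-- `def` does not capture (it ranged too widely before); the overlapping-instances linter is moot.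
set_option linter.overlappingInstances false in
/-- Uniqueness of the free field in terms of `freeFieldMeasure`: any free field of mass `m > 0`
is `freeFieldMeasure d m` (Glimm–Jaffe §6.2, Thm 6.2.3). [folklore]
(Binder repair 2026-08-16: `[NeZero d]` is written in the header so that it is a parameter of the
elaborated constant; as a section instance unused by the body it was silently dropped, so the fact
ranged over cases the printed theorem excludes.) -/
def IsFreeField.eq_freeFieldMeasure [NeZero d] : Prop :=
  ∀ {m : ℝ} (hm : 0 < m) {μ : Measure (FieldConfig (EuclideanSpace ℝ (Fin d)))} (h : IsFreeField m μ),
    μ = freeFieldMeasure d m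

/- interim proof relied on results that are now named facts (D-0014); demoted to a fact by the M5 import, proof preserved:
:=
  (existsUnique_freeField d m hm).unique h (freeFieldMeasure_spec d hm)
-/

end Literature.MathematicalPhysics.QuantumFieldTheory

namespace Literature.MathematicalPhysics.QuantumFieldTheory

variable {d : ℕ} [NeZero d]

/-- **constructive-qft.S07** (the free field satisfies the OS axioms; Glimm–Jaffe (1987) §6.2,
Thm 6.2.4 with Prop. 6.2.2 (Gaussian integrals), Thm 7.10.1 (reflection positivity of
`(-Δ + m²)⁻¹`) and §19.7 (ergodicity); Nelson, JFA 12 (1973); OSforGFF for `d = 4`). The free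
field measure of mass `m > 0` on `𝒮'(ℝ^d)` is a probability measure satisfying OS0 (analyticity,
with exponential moments), OS1 (regularity, with `p = 2`, `c = 1/(2m²)` and locally integrable
two-point kernel), OS2 (Euclidean invariance), OS3 (reflection positivity) and OS4 (ergodicity of
time translations). Known theorem; proof deferred. [cite: GlimmJaffe1987] -/
def _root_.Literature.MathematicalPhysics.QuantumLattice.IsFreeField.isOSMeasure : Prop :=
  ∀ {m : ℝ} {μ : Measure (QuantumLattice.FieldConfig (EuclideanSpace ℝ (Fin d)))} (h : QuantumLattice.IsFreeField m μ) (hm : 0 < m),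
    QuantumLattice.IsOSMeasure d μ

/-- **constructive-qft.S07** (mass gap `m` of the free field; Glimm–Jaffe (1987) §6.2,
Thm 6.2.4: the free Hamiltonian `H₀ = dΓ((-Δ⃗ + m²)^{1/2})` has spectrum `{0} ∪ [m, ∞)`).
Exponential clustering of the free field of mass `m > 0` at rate `m`, in transfer-matrix form:
for real test functions `f` supported at negative times (`θf` positive-time) and `g` supported at
positive times there is `C` with `|⟨ω(f); ω(T_t g)⟩_μ| ≤ C e^{-m t}` for all `t ≥ 0` (here
`⟨ω(f); ω(T_t g)⟩ = C_m(f, T_t g) = ⟨θf̄ Ω, e^{-tH₀} g Ω⟩`). See the module docstring for why the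
prelude's all-Schwartz predicate `HasExponentialClustering d μ m` is *not* asserted (it fails for
test functions with sub-exponential tails). Known theorem; proof deferred. [cite: GlimmJaffe1987] -/
def _root_.Literature.MathematicalPhysics.QuantumLattice.IsFreeField.hasExponentialClustering : Prop :=
  ∀ {m : ℝ} {μ : Measure (QuantumLattice.FieldConfig (EuclideanSpace ℝ (Fin d)))} (h : QuantumLattice.IsFreeField m μ) (hm : 0 < m) (f g : 𝓢(EuclideanSpace ℝ (Fin d), ℝ)) (hf : QuantumLattice.IsPositiveTime (QuantumLattice.thetaTest d f)) (hg : QuantumLattice.IsPositiveTime g),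
    ∃ C : ℝ, ∀ t : ℝ, 0 ≤ t →
      |QuantumLattice.truncatedTwoPoint μ f (QuantumLattice.timeShiftTest d t g)| ≤ C * Real.exp (-m * t)

/-- The two-point function of the free field is the free covariance:
`∫ ω(f) ω(g) dμ_m = C_m(f, g)` (Glimm–Jaffe §6.2, Prop. 6.2.2), and the free field is centred, so
this is also the truncated two-point function. Known; proof deferred (polarisation of
`IsGaussianField.genFunctional_eq` against the defining formula of `IsFreeField`). [cite: GlimmJaffeQP1987, §6.2 Prop. 6.2.2] -/
def _root_.Literature.MathematicalPhysics.QuantumLattice.IsFreeField.twoPoint_eq : Prop :=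
  ∀ {E : Type*} [NormedAddCommGroup E] [InnerProductSpace ℝ E] [FiniteDimensional ℝ E] [MeasurableSpace E] [BorelSpace E] {m : ℝ} {μ : Measure (QuantumLattice.FieldConfig E)} (h : QuantumLattice.IsFreeField m μ) (f g : 𝓢(E, ℝ)),
    QuantumLattice.twoPoint μ f g = QuantumLattice.freeCovarianceReal m f g

end Literature.MathematicalPhysics.QuantumFieldTheory

/-! ### S08: Bochner–Minlos -/

namespace Literature.MathematicalPhysics.QuantumFieldTheory

open QuantumLattice

variable {E : Type*} [NormedAddCommGroup E] [NormedSpace ℝ E] [FiniteDimensional ℝ E]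

/-- **constructive-qft.S08** (Bochner–Minlos theorem; Minlos, Trudy MMO 8 (1959);
Gel'fand–Vilenkin, *Generalized Functions IV*, Ch. IV §2 Thm 2 and §3 Thm 3; Glimm–Jaffe
Thm A.6.1?). A functional `C` on the nuclear space `𝓢(E)` (`E` a finite-dimensional real normed
space, e.g. `ℝ^d`) which is continuous, positive definite and normalised by `C 0 = 1`
(`IsCharacteristicFunctional C`) is the characteristic (generating) functional
`C f = ∫ exp (i ω(f)) dμ(ω)` of a unique Borel probability measure `μ` on `𝒮'(E)` (weak-*
Borel = cylinder σ-algebra). Known theorem; proof deferred. [cite: GelfandVilenkinIV1964, Ch. IV §2 Thm. 2 and §3 Thm. 3 (Minlos)] [cite: GlimmJaffeQP1987, Thm. A.6.1] -/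
def bochner_minlos : Prop :=
  ∀ (C : 𝓢(E, ℝ) → ℂ) (hC : IsCharacteristicFunctional C),
    ∃! μ : Measure (FieldConfig E), IsProbabilityMeasure μ ∧ ∀ f, genFunctional μ f = C f

omit [FiniteDimensional ℝ E] in
/-- The easy half of Bochner–Minlos, re-exported from the prelude
(`isCharacteristicFunctional_genFunctional`): the generating functional of a probability measure
on `𝒮'(E)` is a characteristic functional. Gel'fand–Vilenkin IV §3. [folklore] -/
def genFunctional_isCharacteristicFunctional : Prop :=
  ∀ (μ : Measure (FieldConfig E)) [IsProbabilityMeasure μ],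
    IsCharacteristicFunctional (genFunctional μ)

/- interim proof relied on results that are now named facts (D-0014); demoted to a fact by the M5 import, proof preserved:
:=
  isCharacteristicFunctional_genFunctional μ
-/

-- Binder repair (2026-08-16): the header instance deliberately shadows the section's, which a
-- `def` does not capture (it ranged too widely before); the overlapping-instances linter is moot.
set_option linter.overlappingInstances false in
/-- Bochner–Minlos as an equivalence (Gel'fand–Vilenkin IV, Ch. IV §2 Thm 2): `C : 𝓢(E) → ℂ` is
a characteristic functional iff it is the generating functional of some probability measure on
`𝒮'(E)` (which is then unique, `bochner_minlos`). [folklore]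
(Binder repair 2026-08-16: `[FiniteDimensional ℝ E]` is written in the header so that it is a
parameter of the elaborated constant; as a section instance unused by the body it was silently
dropped, so the fact ranged over cases the printed theorem excludes.) -/
def isCharacteristicFunctional_iff_exists_measure [FiniteDimensional ℝ E] : Prop :=
  ∀ (C : 𝓢(E, ℝ) → ℂ),
    IsCharacteristicFunctional C ↔
      ∃ μ : Measure (FieldConfig E), IsProbabilityMeasure μ ∧ genFunctional μ = C

/- interim proof relied on results that are now named facts (D-0014); demoted to a fact by the M5 import, proof preserved:
:= by
  constructor
  · intro hC
    obtain ⟨μ, ⟨hμ, hμC⟩, -⟩ := bochner_minlos C hC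
    exact ⟨μ, hμ, funext hμC⟩
  · rintro ⟨μ, hμ, rfl⟩
    exact isCharacteristicFunctional_genFunctional μ
-/

end Literature.MathematicalPhysics.QuantumFieldTheory
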